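import Literature.AlgebraicGeometry.ComplexMultiplication.CyclotomicFermatCMTypesBadOddCharacterCount
import HarnessLib

/-!
# Koblitz–Rohrlich's PROPOSITION as a CRITERION (`(pᵢ − 1)·ordᵢ > 6m ⟹ #S₀(N) < #S(N)/6`) and its Cases `m = 4, 5`; THEOREMS 1 (i)–(ii), 2
# UNCONDITIONALLY at levels with four or five prime factors `≥ 5`

Layer `Literature/AlgebraicGeometry/ComplexMultiplication`, namespace `…ComplexMultiplication.CyclotomicFermatCMType`; sequel of
`CyclotomicFermatCMTypesBadOddCharacterCount` (structural count `#S₀(N) ≤ Σ_{ℓ ∣ N} #{ψ mod N_ℓ odd : ψ(ℓ) = 1}`, `2·ord·# ≤ φ(N_ℓ)`) and of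
`CyclotomicFermatCMTypesOddLevelSimple` (Theorems 1–2 at any odd level under `12·#S₀(N) < φ(N)`); companion of `…TwoPrimeLevelSimple`
(`m = 2`) and `…ThreePrimeLevelSimple` (`m = 3`).  THEOREMS ONLY (no definition, no named fact, no `sorry`).  Koblitz–Rohrlich, §2, proof of
the Proposition, p. 1192: "Case 5. `m ≥ 10`.  We show that for all `pᵢ` we have `(pᵢ − 1)ordᵢ > 6m`, which will imply `s(N) = Σᵢ
1/((pᵢ − 1)ordᵢ) < 1/6`."; p. 1191: "Case 3. `m = 4`.  If `pᵢ = 5` or `7`, then `ordᵢ ≥ 9` by Table 1.  This, together with (1) and (2),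
gives … and so `Σᵢ 1/((pᵢ − 1)ordᵢ) < 1/6`.  Case 4. `5 ≤ m ≤ 9`.  From Table 1, if `pᵢ = 5, 7, 11`, then `ordᵢ ≥ 10, 10, 6`, respectively,
and if `13 ≤ pᵢ ≤ 29`, then `ordᵢ ≥ 5`."  THIS FILE turns the sentence of Case 5 into a theorem for EVERY `N` — if `(ℓ − 1)·d ≥ 6ω(N) + 1` for
every prime `ℓ ∣ N` and every `d ≥ 1` with `N_ℓ ∣ ℓᵈ − 1`, then `12·#S₀(N) < φ(N)` — and verifies its hypothesis for every `N` with exactly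
FOUR or FIVE prime factors, all `≥ 5` (K–R's `m = 4` and the `m = 5` instance of Case 4), by Table 1.

## The print

* N. Koblitz, D. Rohrlich, *Simple factors in the Jacobian of a Fermat curve*, Canad. J. Math. **30** (1978) 1183–1205
  [KoblitzRohrlich1978] (held `paper:koblitz1978-simple-factors-jacobian-fermat-curve`, pp. 1185–1192 read): Theorems 1–2 (pp. 1185–1186),
  §2 Proposition (p. 1190), its proof, Cases 3–5 (pp. 1191–1192), quoted above; "TABLE 1. All primes `≥ 5` dividing `pᵐ − 1` for certain `p`
  and `m`" (p. 1190) — the entries used: `5ᵈ − 1 = 4, 24, 4·31, 48·13, 4·11·71, 72·7·31, 4·19531` (`d ≤ 7`), `7ᵈ − 1 = 6, 48, 18·19, 96·25,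
  6·2801` (`d ≤ 5`).
* G. Shimura, *Abelian Varieties with Complex Multiplication and Modular Functions* (1998) [Shimura1998], §8.2 Prop. 26, §8.4 Example (1),
  §6.1 Corollary (through the siblings).

## What is proved

* §1 **THE CRITERION** `twelve_mul_sum_card_lt_totient_of_forall_le` / **`twelve_mul_card_bad_lt_totient_of_forall_le`** /
  `exists_goodFinset_of_forall_le`: for `N ≥ 1` with `m = ω(N)` prime factors, if every prime `ℓ ∣ N` and every `d ≥ 1` with `N_ℓ ∣ ℓᵈ − 1`
  satisfy `6m + 1 ≤ (ℓ − 1)·d`, then `12·Σ_ℓ T_ℓ < φ(N)` and `12·#{χ mod N odd : B_{1,χ} = 0} < φ(N)` (per prime: `2·ord·T_ℓ ≤ φ(N_ℓ)`,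
  `(ℓ − 1)φ(N_ℓ) ≤ φ(ℓ^{v})φ(N_ℓ) = φ(N)`, so `2(6m+1)T_ℓ ≤ φ(N)`; sum: `12·Σ ≤ 12mφ(N)/(2(6m+1)) < φ(N)`).
* §2 **Case 3 (`m = 4`)**: `not_three_primes_dvd_pow_sub_one` (Table 1: three distinct primes `≥ 5` never divide `5ᵈ − 1`, `d ≤ 6`, or
  `7ᵈ − 1`, `d ≤ 4`), `twentyfive_le_sub_one_mul_of_three_primes_dvd` (three distinct primes `≥ 5` dividing `ℓᵈ − 1` force `(ℓ − 1)d ≥ 25`: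
  their product `≥ 385` divides, `ℓ = 5, 7` by the table, `ℓ ≥ 11` by size), hence **`twelve_mul_card_bad_lt_totient_four_primes`**: for EVERY
  `N` with exactly four prime factors, all `≥ 5`, `12·#S₀(N) < φ(N)`; `exists_goodFinset_four_primes`.
* §3 **`m = 5`**: `not_three_primes_dvd_pow_sub_one'` (adds `5⁷ − 1 = 4·19531`, `7⁵ − 1 = 6·2801`), `thirtyone_le_sub_one_mul_of_four_primes_dvd`
  (four distinct primes `≥ 5` dividing `ℓᵈ − 1` force `(ℓ − 1)d ≥ 31`), hence **`twelve_mul_card_bad_lt_totient_five_primes`** and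
  `exists_goodFinset_five_primes`.
* §4 **THEOREMS 1 (i)–(ii) AND 2, RELATIVELY PRIME CASE, UNCONDITIONALLY at every `N` with four or five prime factors, all `≥ 5`**
  (`…_fourFivePrimes` family: `H' = h⁻¹H ⟺ {r₂,s₂,t₂} = {hr₁,hs₁,ht₁}`, (∗), the stabiliser, primitivity / simplicity iff
  `¬(1 + a₀ + a₀² = 0 ∧ a₀ ≠ 1)`, isogeny iff `u`-translates).

## Honest column / NOT here

* K–R's Cases 4 (`6 ≤ m ≤ 9`) and 5 (`m ≥ 10`: "(1) `pᵢ = 5` … `ordᵢ > log₅ n/5 ≥ …`", prime-counting "any sequence of `6` consecutive integers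
  has at most `2` primes", "(6m + 1)⁴ is less than the product of the first `m` primes starting with `5` as soon as `m ≥ 7`") are NOT typed: the
  criterion of §1 is their common form, but its hypothesis is verified here only for `m ∈ {4, 5}` (and `m = 3` in the sibling, whose per-prime
  bound `20 ≥ 19` also fits); `m = 2` needs the parity refinement of `…TwoPrimeLevelSimple` (the criterion's `13 ≤ (ℓ − 1)d` fails at `5³ ≡ 1
  (mod 31)`).  So at levels with six or more prime factors Theorems 1–2 remain conditional on `12·#S₀(N) < φ(N)`.
* The criterion asks `6m + 1 ≤ (ℓ − 1)d` for ALL `d ≥ 1` with `N_ℓ ∣ ℓᵈ − 1` (these are the multiples of `ord_{N_ℓ}(ℓ)`), a convenient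
  strengthening of "for `d = ordᵢ`"; K–R's `s(N)` itself (a rational number) is not formed.
* Levels are described by `N.primeFactors.card` and `∀ ℓ ∈ N.primeFactors, 5 ≤ ℓ` (i.e. `(N, 6) = 1`), any exponents.
* Private: `dvd_pow_orderOf_sub_one''`, `sub_one_mul_totient_ordCompl_le`, `not_dvd_two_pow_mul_three_pow'`, `eq_or_eq_of_dvd`,
  `three_primes_not_dvd`, `le_mul_mul_of_three_primes`, `criterion_five_primes`, `level_hyps₄₅`.

## References

* [KoblitzRohrlich1978] N. Koblitz, D. Rohrlich, Canad. J. Math. 30 (1978) 1183–1205: Theorems 1–2 (pp. 1185–1186), §2 Proposition (p. 1190),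
  Cases 3–5 (pp. 1191–1192), Table 1 (p. 1190).
* [Shimura1998] G. Shimura, *Abelian Varieties with Complex Multiplication and Modular Functions*, §6.1–6.2, §8.2 Prop. 26, §8.4 Example (1).

## Provenance

Cell `pub-hodgecm2` (COR-CM), literature seat `lit-deligne-3` gen 34 (claim KR78-CRITERION; count-neutral, own lane).
-/

noncomputable section

open NumberField

namespace Literature.AlgebraicGeometry.ComplexMultiplication

open Literature.NumberTheory.ComplexMultiplication
open Literature.NumberTheory.LFunctions

namespace CyclotomicFermatCMType

/-! ## §1 Koblitz–Rohrlich's method as a criterion: large orders of the primes modulo the complementary parts -/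

section Criterion

variable {N : ℕ}

/-- `M ∣ m^{ord(m)} − 1` for `m` prime to `M` (private copy of the siblings'). [folklore] -/
private theorem dvd_pow_orderOf_sub_one'' {M : ℕ} [NeZero M] {m : ℕ} (hm : m.Coprime M) :
    M ∣ m ^ orderOf (ZMod.unitOfCoprime m hm) - 1 := by
  have hu : ((m : ZMod M)) ^ orderOf (ZMod.unitOfCoprime m hm) = 1 := by
    rw [← ZMod.coe_unitOfCoprime m hm, ← Units.val_pow_eq_pow_val, pow_orderOf_eq_one, Units.val_one]
  rcases Nat.eq_zero_or_pos m with h0 | hpos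
  · subst h0
    have hM : M = 1 := (Nat.coprime_zero_left _).1 hm
    subst hM
    exact one_dvd _
  have h1 : 1 ≤ m ^ orderOf (ZMod.unitOfCoprime m hm) := Nat.one_le_pow _ _ hpos
  have h : ((m ^ orderOf (ZMod.unitOfCoprime m hm) - 1 : ℕ) : ZMod M) = 0 := by
    rw [Nat.cast_sub h1, Nat.cast_pow, Nat.cast_one, hu, sub_self]
  exact (ZMod.natCast_eq_zero_iff _ _).1 h

/-- `φ(N) = φ(ℓ^{v_ℓ(N)})·φ(N_ℓ) ≥ (ℓ − 1)·φ(N_ℓ)` for a prime `ℓ ∣ N`. [folklore] -/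
private theorem sub_one_mul_totient_ordCompl_le {ℓ : ℕ} (hN : N ≠ 0) (hℓ : ℓ ∈ N.primeFactors) :
    (ℓ - 1) * (ordCompl[ℓ] N).totient ≤ N.totient := by
  have hℓp : ℓ.Prime := Nat.prime_of_mem_primeFactors hℓ
  have hk : 0 < N.factorization ℓ := Nat.Prime.factorization_pos_of_dvd hℓp hN (Nat.dvd_of_mem_primeFactors hℓ)
  have hcop : (ordProj[ℓ] N).Coprime (ordCompl[ℓ] N) := (Nat.coprime_ordCompl hℓp hN).pow_left _
  conv_rhs => rw [← Nat.ordProj_mul_ordCompl_eq_self N ℓ]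
  rw [Nat.totient_mul hcop, Nat.totient_prime_pow hℓp hk]
  refine Nat.mul_le_mul_right _ ?_
  calc ℓ - 1 = 1 * (ℓ - 1) := (one_mul _).symm
    _ ≤ ℓ ^ (N.factorization ℓ - 1) * (ℓ - 1) := Nat.mul_le_mul_right _ (Nat.one_le_pow _ _ hℓp.pos)

/-- **Koblitz–Rohrlich's method as a CRITERION** ("We show that for all `pᵢ` we have `(pᵢ − 1)ordᵢ > 6m`, which will imply `s(N) = Σᵢ
1/((pᵢ − 1)ordᵢ) < 1/6`", p. 1192): let `m = ω(N)` be the number of prime factors of `N ≥ 1`.  If for every prime `ℓ ∣ N` and every `d ≥ 1`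
with `N_ℓ ∣ ℓᵈ − 1` (`N_ℓ = N/ℓ^{v_ℓ(N)}`; in particular for `d = ord_{N_ℓ}(ℓ)`) one has `6m + 1 ≤ (ℓ − 1)·d`, then
`12·Σ_{ℓ ∣ N} #{ψ mod N_ℓ odd : ψ(ℓ) = 1} < φ(N)` (each summand `T_ℓ` has `2·ord·T_ℓ ≤ φ(N_ℓ)` and `(ℓ − 1)φ(N_ℓ) ≤ φ(N)`, so
`2(6m+1)·T_ℓ ≤ φ(N)`; summing, `12·Σ T_ℓ ≤ 6m·φ(N)/(6m+1) < φ(N)`). [cite: KoblitzRohrlich1978, §2 proof of the Proposition, Case 5 (p. 1192)] -/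
theorem twelve_mul_sum_card_lt_totient_of_forall_le (hN : N ≠ 0)
    (h : ∀ ℓ ∈ N.primeFactors, ∀ d : ℕ, 0 < d → ordCompl[ℓ] N ∣ ℓ ^ d - 1 → 6 * N.primeFactors.card + 1 ≤ (ℓ - 1) * d) :
    12 * ∑ ℓ ∈ N.primeFactors,
        Nat.card {ψ : DirichletCharacter ℂ (ordCompl[ℓ] N) // ψ.Odd ∧ ψ (ℓ : ZMod (ordCompl[ℓ] N)) = 1} < N.totient := by
  haveI hM : ∀ ℓ, NeZero (ordCompl[ℓ] N) := fun ℓ => ⟨(Nat.ordCompl_pos ℓ hN).ne'⟩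
  set c := 6 * N.primeFactors.card + 1 with hc
  -- per-prime bound `2c·T_ℓ ≤ φ(N)`
  have hper : ∀ ℓ ∈ N.primeFactors,
      2 * c * Nat.card {ψ : DirichletCharacter ℂ (ordCompl[ℓ] N) // ψ.Odd ∧ ψ (ℓ : ZMod (ordCompl[ℓ] N)) = 1} ≤ N.totient := by
    intro ℓ hℓ
    have hℓp : ℓ.Prime := Nat.prime_of_mem_primeFactors hℓ
    have hcop : ℓ.Coprime (ordCompl[ℓ] N) := Nat.coprime_ordCompl hℓp hN
    have hT : Nat.card {ψ : DirichletCharacter ℂ (ordCompl[ℓ] N) // ψ.Odd ∧ ψ (ℓ : ZMod (ordCompl[ℓ] N)) = 1} =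
        Nat.card {ψ : DirichletCharacter ℂ (ordCompl[ℓ] N) // ψ.Odd ∧ ψ (ZMod.unitOfCoprime ℓ hcop) = 1} := by
      refine Nat.card_congr (Equiv.subtypeEquivRight fun ψ => ?_)
      rw [ZMod.coe_unitOfCoprime]
    rw [hT]
    set T := Nat.card {ψ : DirichletCharacter ℂ (ordCompl[ℓ] N) // ψ.Odd ∧ ψ (ZMod.unitOfCoprime ℓ hcop) = 1}
    set d := orderOf (ZMod.unitOfCoprime ℓ hcop) with hd
    have h2 : 2 * d * T ≤ (ordCompl[ℓ] N).totient := two_mul_orderOf_mul_card_odd_apply_eq_one_le _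
    have hcd : c ≤ (ℓ - 1) * d := h ℓ hℓ d (orderOf_pos _) (dvd_pow_orderOf_sub_one'' hcop)
    calc 2 * c * T ≤ 2 * ((ℓ - 1) * d) * T := Nat.mul_le_mul_right _ (Nat.mul_le_mul_left 2 hcd)
      _ = (ℓ - 1) * (2 * d * T) := by ring
      _ ≤ (ℓ - 1) * (ordCompl[ℓ] N).totient := Nat.mul_le_mul_left _ h2
      _ ≤ N.totient := sub_one_mul_totient_ordCompl_le hN hℓ
  have hsum : 2 * c * ∑ ℓ ∈ N.primeFactors,
      Nat.card {ψ : DirichletCharacter ℂ (ordCompl[ℓ] N) // ψ.Odd ∧ ψ (ℓ : ZMod (ordCompl[ℓ] N)) = 1} ≤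
        N.primeFactors.card * N.totient := by
    rw [Finset.mul_sum]
    have := Finset.sum_le_sum hper
    rwa [Finset.sum_const, smul_eq_mul] at this
  have hφ : 0 < N.totient := Nat.totient_pos.2 (Nat.pos_of_ne_zero hN)
  set S := ∑ ℓ ∈ N.primeFactors,
      Nat.card {ψ : DirichletCharacter ℂ (ordCompl[ℓ] N) // ψ.Odd ∧ ψ (ℓ : ZMod (ordCompl[ℓ] N)) = 1}
  set m := N.primeFactors.card
  -- `2c·12·S ≤ 12m·φ(N) < 2c·φ(N)`
  have h1 : 2 * c * (12 * S) ≤ 12 * (m * N.totient) := by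
    calc 2 * c * (12 * S) = 12 * (2 * c * S) := by ring
      _ ≤ 12 * (m * N.totient) := Nat.mul_le_mul_left _ hsum
  have h2 : 12 * (m * N.totient) < 2 * c * N.totient := by
    rw [hc]
    nlinarith
  exact Nat.lt_of_mul_lt_mul_left (lt_of_le_of_lt h1 h2)

/-- The criterion in terms of the bad odd characters: `12·#{χ mod N odd : B_{1,χ} = 0} < φ(N)` (`#S₀(N) < #S(N)/6`) under the same hypothesis.
[cite: KoblitzRohrlich1978, §2 Proposition (p. 1190) and Case 5 (p. 1192)] -/
theorem twelve_mul_card_bad_lt_totient_of_forall_le [NeZero N]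
    (h : ∀ ℓ ∈ N.primeFactors, ∀ d : ℕ, 0 < d → ordCompl[ℓ] N ∣ ℓ ^ d - 1 → 6 * N.primeFactors.card + 1 ≤ (ℓ - 1) * d) :
    12 * Nat.card {χ : DirichletCharacter ℂ N // χ.Odd ∧ bernoulliOneChar χ = 0} < N.totient :=
  lt_of_le_of_lt (Nat.mul_le_mul_left _ card_odd_bernoulliOneChar_eq_zero_le)
    (twelve_mul_sum_card_lt_totient_of_forall_le (NeZero.ne N) h)

/-- The criterion produces the hypothesis of `CyclotomicFermatCMTypesOddLevelSimple`. [cite: KoblitzRohrlich1978, §2 Proposition (p. 1190)] -/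
theorem exists_goodFinset_of_forall_le [NeZero N]
    (h : ∀ ℓ ∈ N.primeFactors, ∀ d : ℕ, 0 < d → ordCompl[ℓ] N ∣ ℓ ^ d - 1 → 6 * N.primeFactors.card + 1 ≤ (ℓ - 1) * d) :
    ∃ S₀ : Finset (DirichletCharacter ℂ N),
      (∀ ψ : DirichletCharacter ℂ N, ψ.Odd → bernoulliOneChar ψ = 0 → ψ ∈ S₀) ∧ 12 * S₀.card < N.totient :=
  exists_goodFinset_of_sum_lt (twelve_mul_sum_card_lt_totient_of_forall_le (NeZero.ne N) h)

end Criterion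

/-! ## §2 Table 1 and K–R's "Case 3. `m = 4`": three distinct primes `≥ 5` dividing `ℓᵈ − 1` force `(ℓ − 1)·d ≥ 25` -/

section CaseThree

variable {N : ℕ}

/-- A prime `≥ 5` does not divide `2ⁱ·3ʲ` (private copy). [folklore] -/
private theorem not_dvd_two_pow_mul_three_pow' {q : ℕ} (hq : q.Prime) (h5 : 5 ≤ q) (i j : ℕ) : ¬q ∣ 2 ^ i * 3 ^ j := by
  intro h
  rcases (Nat.Prime.dvd_mul hq).1 h with h2 | h3
  · have := (Nat.prime_dvd_prime_iff_eq hq Nat.prime_two).1 (hq.dvd_of_dvd_pow h2)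
    omega
  · have := (Nat.prime_dvd_prime_iff_eq hq Nat.prime_three).1 (hq.dvd_of_dvd_pow h3)
    omega

/-- A prime `q ≥ 5` dividing `2ⁱ·3ʲ·sᵏ·tˡ` (`s, t` prime) is `s` or `t`. [folklore] -/
private theorem eq_or_eq_of_dvd {q s t i j k l : ℕ} (hq : q.Prime) (h5 : 5 ≤ q) (hs : s.Prime) (ht : t.Prime)
    (h : q ∣ 2 ^ i * 3 ^ j * s ^ k * t ^ l) : q = s ∨ q = t := by
  rcases (Nat.Prime.dvd_mul hq).1 h with h1 | h1
  · rcases (Nat.Prime.dvd_mul hq).1 h1 with h2 | h2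
    · exact absurd h2 (not_dvd_two_pow_mul_three_pow' hq h5 i j)
    · exact Or.inl ((Nat.prime_dvd_prime_iff_eq hq hs).1 (hq.dvd_of_dvd_pow h2))
  · exact Or.inr ((Nat.prime_dvd_prime_iff_eq hq ht).1 (hq.dvd_of_dvd_pow h1))

/-- Three distinct primes `≥ 5` cannot all divide a number of the form `2ⁱ·3ʲ·sᵏ·tˡ`. [folklore] -/
private theorem three_primes_not_dvd {X s t i j k l q₁ q₂ q₃ : ℕ} (hX : X = 2 ^ i * 3 ^ j * s ^ k * t ^ l) (hs : s.Prime)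
    (ht : t.Prime) (h₁ : q₁.Prime) (h₂ : q₂.Prime) (h₃ : q₃.Prime) (h₁5 : 5 ≤ q₁) (h₂5 : 5 ≤ q₂) (h₃5 : 5 ≤ q₃)
    (h₁₂ : q₁ ≠ q₂) (h₁₃ : q₁ ≠ q₃) (h₂₃ : q₂ ≠ q₃) (d₁ : q₁ ∣ X) (d₂ : q₂ ∣ X) (d₃ : q₃ ∣ X) : False := by
  subst hX
  rcases eq_or_eq_of_dvd h₁ h₁5 hs ht d₁ with rfl | rfl <;>
    rcases eq_or_eq_of_dvd h₂ h₂5 hs ht d₂ with e₂ | e₂ <;>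
      rcases eq_or_eq_of_dvd h₃ h₃5 hs ht d₃ with e₃ | e₃ <;> omega

/-- **TABLE 1, the entries `5ᵈ − 1` (`d ≤ 6`) and `7ᵈ − 1` (`d ≤ 4`)**: none is divisible by three distinct primes `≥ 5` (`5ᵈ − 1 = 4, 24, 4·31,
48·13, 4·11·71, 72·7·31`; `7ᵈ − 1 = 6, 48, 18·19, 96·25`). [cite: KoblitzRohrlich1978, §2 Table 1 (p. 1190) and Case 3 (p. 1191)] -/
theorem not_three_primes_dvd_pow_sub_one {ℓ d q₁ q₂ q₃ : ℕ} (hℓ : (ℓ = 5 ∧ d ≤ 6) ∨ (ℓ = 7 ∧ d ≤ 4)) (hd : 0 < d)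
    (h₁ : q₁.Prime) (h₂ : q₂.Prime) (h₃ : q₃.Prime) (h₁5 : 5 ≤ q₁) (h₂5 : 5 ≤ q₂) (h₃5 : 5 ≤ q₃)
    (h₁₂ : q₁ ≠ q₂) (h₁₃ : q₁ ≠ q₃) (h₂₃ : q₂ ≠ q₃) (d₁ : q₁ ∣ ℓ ^ d - 1) (d₂ : q₂ ∣ ℓ ^ d - 1) (d₃ : q₃ ∣ ℓ ^ d - 1) : False := by
  have key : ∀ {i j s k t l : ℕ}, s.Prime → t.Prime → ℓ ^ d - 1 = 2 ^ i * 3 ^ j * s ^ k * t ^ l → False :=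
    fun hs ht he => three_primes_not_dvd he hs ht h₁ h₂ h₃ h₁5 h₂5 h₃5 h₁₂ h₁₃ h₂₃ d₁ d₂ d₃
  rcases hℓ with ⟨rfl, hd6⟩ | ⟨rfl, hd4⟩
  · have hd' : d = 1 ∨ d = 2 ∨ d = 3 ∨ d = 4 ∨ d = 5 ∨ d = 6 := by omega
    rcases hd' with rfl | rfl | rfl | rfl | rfl | rfl
    · exact key (i := 2) (j := 0) (s := 5) (k := 0) (t := 5) (l := 0) (by norm_num) (by norm_num) (by norm_num)
    · exact key (i := 3) (j := 1) (s := 5) (k := 0) (t := 5) (l := 0) (by norm_num) (by norm_num) (by norm_num)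
    · exact key (i := 2) (j := 0) (s := 31) (k := 1) (t := 5) (l := 0) (by norm_num) (by norm_num) (by norm_num)
    · exact key (i := 4) (j := 1) (s := 13) (k := 1) (t := 5) (l := 0) (by norm_num) (by norm_num) (by norm_num)
    · exact key (i := 2) (j := 0) (s := 11) (k := 1) (t := 71) (l := 1) (by norm_num) (by norm_num) (by norm_num)
    · exact key (i := 3) (j := 2) (s := 7) (k := 1) (t := 31) (l := 1) (by norm_num) (by norm_num) (by norm_num)
  · have hd' : d = 1 ∨ d = 2 ∨ d = 3 ∨ d = 4 := by omega
    rcases hd' with rfl | rfl | rfl | rfl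
    · exact key (i := 1) (j := 1) (s := 5) (k := 0) (t := 5) (l := 0) (by norm_num) (by norm_num) (by norm_num)
    · exact key (i := 4) (j := 1) (s := 5) (k := 0) (t := 5) (l := 0) (by norm_num) (by norm_num) (by norm_num)
    · exact key (i := 1) (j := 2) (s := 19) (k := 1) (t := 5) (l := 0) (by norm_num) (by norm_num) (by norm_num)
    · exact key (i := 5) (j := 1) (s := 5) (k := 2) (t := 5) (l := 0) (by norm_num) (by norm_num) (by norm_num)

/-- The product of three distinct primes `≥ 5` is at least `5·7·11 = 385`. [folklore] -/
private theorem le_mul_mul_of_three_primes {q₁ q₂ q₃ : ℕ} (h₁ : q₁.Prime) (h₂ : q₂.Prime) (h₃ : q₃.Prime) (h₁5 : 5 ≤ q₁)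
    (h₂5 : 5 ≤ q₂) (h₃5 : 5 ≤ q₃) (h₁₂ : q₁ ≠ q₂) (h₁₃ : q₁ ≠ q₃) (h₂₃ : q₂ ≠ q₃) : 385 ≤ q₁ * q₂ * q₃ := by
  -- the primes in `[5, 11)` are `5` and `7`
  have small : ∀ {q : ℕ}, q.Prime → 5 ≤ q → q < 11 → q = 5 ∨ q = 7 := by
    intro q hq h5 h11
    interval_cases q
    · exact Or.inl rfl
    · exact absurd hq (by decide)
    · exact Or.inr rfl
    · exact absurd hq (by decide)
    · exact absurd hq (by decide)
    · exact absurd hq (by decide)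
  have h6 : ∀ {q : ℕ}, q.Prime → 5 ≤ q → q ≠ 5 → 7 ≤ q := by
    intro q hq h5 hne
    have : q ≠ 6 := fun h => by rw [h] at hq; exact absurd hq (by decide)
    omega
  -- some prime is `≥ 11`; the other two are distinct `≥ 5`, so their product is `≥ 35`
  have pair : ∀ {x y : ℕ}, x.Prime → y.Prime → 5 ≤ x → 5 ≤ y → x ≠ y → 35 ≤ x * y := by
    intro x y hx hy hx5 hy5 hxy
    by_cases hx' : x = 5
    · subst hx'
      have := h6 hy hy5 (Ne.symm hxy)
      nlinarith
    · have := h6 hx hx5 hx'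
      nlinarith
  by_cases g₁ : 11 ≤ q₁
  · have := pair h₂ h₃ h₂5 h₃5 h₂₃
    nlinarith
  by_cases g₂ : 11 ≤ q₂
  · have := pair h₁ h₃ h₁5 h₃5 h₁₃
    nlinarith
  by_cases g₃ : 11 ≤ q₃
  · have := pair h₁ h₂ h₁5 h₂5 h₁₂
    nlinarith
  exfalso
  rcases small h₁ h₁5 (by omega) with rfl | rfl <;> rcases small h₂ h₂5 (by omega) with rfl | rfl <;>
    rcases small h₃ h₃5 (by omega) with e | e <;> omega

/-- **`(ℓ − 1)·d ≥ 25` when three distinct primes `≥ 5` divide `ℓᵈ − 1`** (`ℓ` prime `≥ 5`, `d ≥ 1`) — K–R's bounds of Case 3 (`m = 4`): `ℓ = 5`: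
`d ≥ 7` by Table 1; `ℓ = 7`: `d ≥ 5` by Table 1; `ℓ ≥ 11`: `ℓᵈ > 385`, so `d = 1 ⟹ ℓ ≥ 386`, `d = 2 ⟹ ℓ ≥ 20`, else `d ≥ 3`
("If `pᵢ = 5` or `7`, then `ordᵢ ≥ 9` by Table 1.  This, together with (1) and (2), gives … `Σᵢ < 1/6`"; here the uniform `1/25 < 1/24`).
[cite: KoblitzRohrlich1978, §2 Proposition, Case 3 (pp. 1191–1192)] -/
theorem twentyfive_le_sub_one_mul_of_three_primes_dvd {ℓ d q₁ q₂ q₃ : ℕ} (hℓ : ℓ.Prime) (hℓ5 : 5 ≤ ℓ) (hd : 0 < d)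
    (h₁ : q₁.Prime) (h₂ : q₂.Prime) (h₃ : q₃.Prime) (h₁5 : 5 ≤ q₁) (h₂5 : 5 ≤ q₂) (h₃5 : 5 ≤ q₃)
    (h₁₂ : q₁ ≠ q₂) (h₁₃ : q₁ ≠ q₃) (h₂₃ : q₂ ≠ q₃) (d₁ : q₁ ∣ ℓ ^ d - 1) (d₂ : q₂ ∣ ℓ ^ d - 1) (d₃ : q₃ ∣ ℓ ^ d - 1) :
    25 ≤ (ℓ - 1) * d := by
  -- the product divides, so `ℓᵈ ≥ 386`
  have hprod : q₁ * q₂ * q₃ ∣ ℓ ^ d - 1 :=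
    Nat.Coprime.mul_dvd_of_dvd_of_dvd
      (Nat.Coprime.mul_left ((Nat.coprime_primes h₁ h₃).2 h₁₃) ((Nat.coprime_primes h₂ h₃).2 h₂₃))
      (Nat.Coprime.mul_dvd_of_dvd_of_dvd ((Nat.coprime_primes h₁ h₂).2 h₁₂) d₁ d₂) d₃
  have h385 := le_mul_mul_of_three_primes h₁ h₂ h₃ h₁5 h₂5 h₃5 h₁₂ h₁₃ h₂₃
  have hℓd1 : 1 ≤ ℓ ^ d := Nat.one_le_pow _ _ hℓ.pos
  have hpos : 0 < ℓ ^ d - 1 := by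
    have : ℓ ^ 1 ≤ ℓ ^ d := Nat.pow_le_pow_right hℓ.pos hd
    rw [pow_one] at this
    omega
  have hle : q₁ * q₂ * q₃ ≤ ℓ ^ d - 1 := Nat.le_of_dvd hpos hprod
  have h386 : 386 ≤ ℓ ^ d := by omega
  by_cases h11 : 11 ≤ ℓ
  · -- `ℓ ≥ 11`
    rcases Nat.lt_or_ge d 3 with hd3 | hd3
    · have hd12 : d = 1 ∨ d = 2 := by omega
      rcases hd12 with rfl | rfl
      · rw [pow_one] at h386
        omega
      · have h20 : 20 ≤ ℓ := by nlinarith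
        omega
    · calc 25 ≤ 10 * 3 := by norm_num
        _ ≤ (ℓ - 1) * d := Nat.mul_le_mul (by omega) hd3
  · have hℓ57 : ℓ = 5 ∨ ℓ = 7 := by
      interval_cases ℓ
      · exact Or.inl rfl
      · exact absurd hℓ (by decide)
      · exact Or.inr rfl
      · exact absurd hℓ (by decide)
      · exact absurd hℓ (by decide)
      · exact absurd hℓ (by decide)
    rcases hℓ57 with rfl | rfl
    · have hd7 : 7 ≤ d := by
        by_contra hlt
        exact not_three_primes_dvd_pow_sub_one (Or.inl ⟨rfl, by omega⟩) hd h₁ h₂ h₃ h₁5 h₂5 h₃5 h₁₂ h₁₃ h₂₃ d₁ d₂ d₃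
      omega
    · have hd5 : 5 ≤ d := by
        by_contra hlt
        exact not_three_primes_dvd_pow_sub_one (Or.inr ⟨rfl, by omega⟩) hd h₁ h₂ h₃ h₁5 h₂5 h₃5 h₁₂ h₁₃ h₂₃ d₁ d₂ d₃
      omega

/-- **THE PROPOSITION AT FOUR-PRIME LEVELS** ("Case 3. `m = 4`"): if `N` has exactly four prime factors, all `≥ 5`, then
`12·#{χ mod N odd : B_{1,χ} = 0} < φ(N)` (for each `ℓ ∣ N` the other three primes divide `N_ℓ ∣ ℓ^{ord} − 1`, so `(ℓ − 1)·ord ≥ 25 = 6·4 + 1`).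
[cite: KoblitzRohrlich1978, §2 Proposition (p. 1190) and Case 3 (pp. 1191–1192)] -/
theorem twelve_mul_card_bad_lt_totient_four_primes [NeZero N] (hcard : N.primeFactors.card = 4)
    (h5 : ∀ ℓ ∈ N.primeFactors, 5 ≤ ℓ) :
    12 * Nat.card {χ : DirichletCharacter ℂ N // χ.Odd ∧ bernoulliOneChar χ = 0} < N.totient := by
  classical
  refine twelve_mul_card_bad_lt_totient_of_forall_le fun ℓ hℓ d hd hdvd => ?_
  rw [hcard]
  have hℓp : ℓ.Prime := Nat.prime_of_mem_primeFactors hℓ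
  -- the other three prime factors
  have h3 : (N.primeFactors.erase ℓ).card = 3 := by rw [Finset.card_erase_of_mem hℓ, hcard]
  obtain ⟨q₁, q₂, q₃, h₁₂, h₁₃, h₂₃, he⟩ := Finset.card_eq_three.1 h3
  have mem : ∀ {q : ℕ}, q ∈ N.primeFactors.erase ℓ → q.Prime ∧ 5 ≤ q ∧ q ∣ ℓ ^ d - 1 := by
    intro q hq
    obtain ⟨hqℓ, hqN⟩ := Finset.mem_erase.1 hq
    have hqp : q.Prime := Nat.prime_of_mem_primeFactors hqN
    refine ⟨hqp, h5 q hqN, dvd_trans (Nat.dvd_ordCompl_of_dvd_not_dvd (Nat.dvd_of_mem_primeFactors hqN) ?_) hdvd⟩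
    intro h
    exact hqℓ ((Nat.prime_dvd_prime_iff_eq hℓp hqp).1 h).symm
  have m₁ : q₁ ∈ N.primeFactors.erase ℓ := by rw [he]; simp
  have m₂ : q₂ ∈ N.primeFactors.erase ℓ := by rw [he]; simp
  have m₃ : q₃ ∈ N.primeFactors.erase ℓ := by rw [he]; simp
  obtain ⟨p₁, f₁, e₁⟩ := mem m₁
  obtain ⟨p₂, f₂, e₂⟩ := mem m₂
  obtain ⟨p₃, f₃, e₃⟩ := mem m₃
  exact twentyfive_le_sub_one_mul_of_three_primes_dvd hℓp (h5 ℓ hℓ) hd p₁ p₂ p₃ f₁ f₂ f₃ h₁₂ h₁₃ h₂₃ e₁ e₂ e₃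

/-- The sibling's hypothesis at four-prime levels. [cite: KoblitzRohrlich1978, §2 Proposition (p. 1190) and Case 3 (pp. 1191–1192)] -/
theorem exists_goodFinset_four_primes [NeZero N] (hcard : N.primeFactors.card = 4) (h5 : ∀ ℓ ∈ N.primeFactors, 5 ≤ ℓ) :
    ∃ S₀ : Finset (DirichletCharacter ℂ N),
      (∀ ψ : DirichletCharacter ℂ N, ψ.Odd → bernoulliOneChar ψ = 0 → ψ ∈ S₀) ∧ 12 * S₀.card < N.totient := by
  classical
  refine exists_goodFinset_of_forall_le fun ℓ hℓ d hd hdvd => ?_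
  rw [hcard]
  have hℓp : ℓ.Prime := Nat.prime_of_mem_primeFactors hℓ
  have h3 : (N.primeFactors.erase ℓ).card = 3 := by rw [Finset.card_erase_of_mem hℓ, hcard]
  obtain ⟨q₁, q₂, q₃, h₁₂, h₁₃, h₂₃, he⟩ := Finset.card_eq_three.1 h3
  have mem : ∀ {q : ℕ}, q ∈ N.primeFactors.erase ℓ → q.Prime ∧ 5 ≤ q ∧ q ∣ ℓ ^ d - 1 := by
    intro q hq
    obtain ⟨hqℓ, hqN⟩ := Finset.mem_erase.1 hq
    have hqp : q.Prime := Nat.prime_of_mem_primeFactors hqN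
    refine ⟨hqp, h5 q hqN, dvd_trans (Nat.dvd_ordCompl_of_dvd_not_dvd (Nat.dvd_of_mem_primeFactors hqN) ?_) hdvd⟩
    intro h
    exact hqℓ ((Nat.prime_dvd_prime_iff_eq hℓp hqp).1 h).symm
  have m₁ : q₁ ∈ N.primeFactors.erase ℓ := by rw [he]; simp
  have m₂ : q₂ ∈ N.primeFactors.erase ℓ := by rw [he]; simp
  have m₃ : q₃ ∈ N.primeFactors.erase ℓ := by rw [he]; simp
  obtain ⟨p₁, f₁, e₁⟩ := mem m₁
  obtain ⟨p₂, f₂, e₂⟩ := mem m₂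
  obtain ⟨p₃, f₃, e₃⟩ := mem m₃
  exact twentyfive_le_sub_one_mul_of_three_primes_dvd hℓp (h5 ℓ hℓ) hd p₁ p₂ p₃ f₁ f₂ f₃ h₁₂ h₁₃ h₂₃ e₁ e₂ e₃

end CaseThree

/-! ## §3 "Case 4" for `m = 5`: four distinct primes `≥ 5` dividing `ℓᵈ − 1` force `(ℓ − 1)·d ≥ 31` -/

section CaseFour

variable {N : ℕ}

/-- **TABLE 1, the entries `5⁷ − 1 = 4·19531` and `7⁵ − 1 = 6·2801`** (`19531`, `2801` prime) together with §2: for `ℓ = 5`, `d ≤ 7` and for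
`ℓ = 7`, `d ≤ 5`, three distinct primes `≥ 5` cannot divide `ℓᵈ − 1`. [cite: KoblitzRohrlich1978, §2 Table 1 (p. 1190) and Case 4 (p. 1191)] -/
theorem not_three_primes_dvd_pow_sub_one' {ℓ d q₁ q₂ q₃ : ℕ} (hℓ : (ℓ = 5 ∧ d ≤ 7) ∨ (ℓ = 7 ∧ d ≤ 5)) (hd : 0 < d)
    (h₁ : q₁.Prime) (h₂ : q₂.Prime) (h₃ : q₃.Prime) (h₁5 : 5 ≤ q₁) (h₂5 : 5 ≤ q₂) (h₃5 : 5 ≤ q₃)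
    (h₁₂ : q₁ ≠ q₂) (h₁₃ : q₁ ≠ q₃) (h₂₃ : q₂ ≠ q₃) (d₁ : q₁ ∣ ℓ ^ d - 1) (d₂ : q₂ ∣ ℓ ^ d - 1) (d₃ : q₃ ∣ ℓ ^ d - 1) : False := by
  have key : ∀ {i j s k t l : ℕ}, s.Prime → t.Prime → ℓ ^ d - 1 = 2 ^ i * 3 ^ j * s ^ k * t ^ l → False :=
    fun hs ht he => three_primes_not_dvd he hs ht h₁ h₂ h₃ h₁5 h₂5 h₃5 h₁₂ h₁₃ h₂₃ d₁ d₂ d₃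
  rcases hℓ with ⟨rfl, hd7⟩ | ⟨rfl, hd5⟩
  · rcases Nat.lt_or_ge d 7 with hlt | hge
    · exact not_three_primes_dvd_pow_sub_one (Or.inl ⟨rfl, by omega⟩) hd h₁ h₂ h₃ h₁5 h₂5 h₃5 h₁₂ h₁₃ h₂₃ d₁ d₂ d₃
    · have hd' : d = 7 := by omega
      subst hd'
      exact key (i := 2) (j := 0) (s := 19531) (k := 1) (t := 5) (l := 0) (by norm_num) (by norm_num) (by norm_num)
  · rcases Nat.lt_or_ge d 5 with hlt | hge
    · exact not_three_primes_dvd_pow_sub_one (Or.inr ⟨rfl, by omega⟩) hd h₁ h₂ h₃ h₁5 h₂5 h₃5 h₁₂ h₁₃ h₂₃ d₁ d₂ d₃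
    · have hd' : d = 5 := by omega
      subst hd'
      exact key (i := 1) (j := 1) (s := 2801) (k := 1) (t := 5) (l := 0) (by norm_num) (by norm_num) (by norm_num)

/-- **`(ℓ − 1)·d ≥ 31` when four distinct primes `≥ 5` divide `ℓᵈ − 1`** (`ℓ` prime `≥ 5`, `d ≥ 1`) — the bounds of K–R's Case 4 at `m = 5`
("if `pᵢ = 5, 7, 11`, then `ordᵢ ≥ 10, 10, 6`, respectively, and if `13 ≤ pᵢ ≤ 29`, then `ordᵢ ≥ 5`"; here: `ℓ = 5`: `d ≥ 8`; `ℓ = 7`: `d ≥ 6`;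
`ℓ ≥ 11`: `ℓᵈ > 5·385`). [cite: KoblitzRohrlich1978, §2 Proposition, Case 4 (pp. 1191–1192)] -/
theorem thirtyone_le_sub_one_mul_of_four_primes_dvd {ℓ d q₁ q₂ q₃ q₄ : ℕ} (hℓ : ℓ.Prime) (hℓ5 : 5 ≤ ℓ) (hd : 0 < d)
    (h₁ : q₁.Prime) (h₂ : q₂.Prime) (h₃ : q₃.Prime) (h₄ : q₄.Prime) (h₁5 : 5 ≤ q₁) (h₂5 : 5 ≤ q₂) (h₃5 : 5 ≤ q₃) (h₄5 : 5 ≤ q₄)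
    (h₁₂ : q₁ ≠ q₂) (h₁₃ : q₁ ≠ q₃) (h₂₃ : q₂ ≠ q₃) (h₁₄ : q₁ ≠ q₄) (h₂₄ : q₂ ≠ q₄) (h₃₄ : q₃ ≠ q₄)
    (d₁ : q₁ ∣ ℓ ^ d - 1) (d₂ : q₂ ∣ ℓ ^ d - 1) (d₃ : q₃ ∣ ℓ ^ d - 1) (d₄ : q₄ ∣ ℓ ^ d - 1) :
    31 ≤ (ℓ - 1) * d := by
  have hprod3 : q₁ * q₂ * q₃ ∣ ℓ ^ d - 1 :=
    Nat.Coprime.mul_dvd_of_dvd_of_dvd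
      (Nat.Coprime.mul_left ((Nat.coprime_primes h₁ h₃).2 h₁₃) ((Nat.coprime_primes h₂ h₃).2 h₂₃))
      (Nat.Coprime.mul_dvd_of_dvd_of_dvd ((Nat.coprime_primes h₁ h₂).2 h₁₂) d₁ d₂) d₃
  have hprod : q₁ * q₂ * q₃ * q₄ ∣ ℓ ^ d - 1 :=
    Nat.Coprime.mul_dvd_of_dvd_of_dvd
      (Nat.Coprime.mul_left (Nat.Coprime.mul_left ((Nat.coprime_primes h₁ h₄).2 h₁₄) ((Nat.coprime_primes h₂ h₄).2 h₂₄))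
        ((Nat.coprime_primes h₃ h₄).2 h₃₄)) hprod3 d₄
  have h385 := le_mul_mul_of_three_primes h₁ h₂ h₃ h₁5 h₂5 h₃5 h₁₂ h₁₃ h₂₃
  have h1925 : 1925 ≤ q₁ * q₂ * q₃ * q₄ := by nlinarith
  have hpos : 0 < ℓ ^ d - 1 := by
    have : ℓ ^ 1 ≤ ℓ ^ d := Nat.pow_le_pow_right hℓ.pos hd
    rw [pow_one] at this
    omega
  have hle : q₁ * q₂ * q₃ * q₄ ≤ ℓ ^ d - 1 := Nat.le_of_dvd hpos hprod
  have h1926 : 1926 ≤ ℓ ^ d := by omega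
  by_cases h11 : 11 ≤ ℓ
  · rcases Nat.lt_or_ge d 3 with hd3 | hd3
    · have hd12 : d = 1 ∨ d = 2 := by omega
      rcases hd12 with rfl | rfl
      · rw [pow_one] at h1926
        omega
      · have h44 : 44 ≤ ℓ := by nlinarith
        omega
    · by_cases h13 : 13 ≤ ℓ
      · calc 31 ≤ 12 * 3 := by norm_num
          _ ≤ (ℓ - 1) * d := Nat.mul_le_mul (by omega) hd3
      · -- `ℓ ∈ {11, 12}`, prime: `ℓ = 11`, and `11³ = 1331 < 1926` forces `d ≥ 4`
        have hℓ11 : ℓ = 11 := by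
          have : ℓ ≠ 12 := fun h => by rw [h] at hℓ; exact absurd hℓ (by decide)
          omega
        subst hℓ11
        have hd4 : 4 ≤ d := by
          by_contra hlt
          have hd3' : d = 3 := by omega
          rw [hd3'] at h1926
          norm_num at h1926
        omega
  · have hℓ57 : ℓ = 5 ∨ ℓ = 7 := by
      interval_cases ℓ
      · exact Or.inl rfl
      · exact absurd hℓ (by decide)
      · exact Or.inr rfl
      · exact absurd hℓ (by decide)
      · exact absurd hℓ (by decide)
      · exact absurd hℓ (by decide)
    rcases hℓ57 with rfl | rfl
    · have hd8 : 8 ≤ d := by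
        by_contra hlt
        exact not_three_primes_dvd_pow_sub_one' (Or.inl ⟨rfl, by omega⟩) hd h₁ h₂ h₃ h₁5 h₂5 h₃5 h₁₂ h₁₃ h₂₃ d₁ d₂ d₃
      omega
    · have hd6 : 6 ≤ d := by
        by_contra hlt
        exact not_three_primes_dvd_pow_sub_one' (Or.inr ⟨rfl, by omega⟩) hd h₁ h₂ h₃ h₁5 h₂5 h₃5 h₁₂ h₁₃ h₂₃ d₁ d₂ d₃
      omega

/-- The criterion's hypothesis at levels with five prime factors `≥ 5`. [cite: KoblitzRohrlich1978, §2 Proposition, Case 4 (pp. 1191–1192)] -/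
private theorem criterion_five_primes (hcard : N.primeFactors.card = 5) (h5 : ∀ ℓ ∈ N.primeFactors, 5 ≤ ℓ) :
    ∀ ℓ ∈ N.primeFactors, ∀ d : ℕ, 0 < d → ordCompl[ℓ] N ∣ ℓ ^ d - 1 → 6 * N.primeFactors.card + 1 ≤ (ℓ - 1) * d := by
  classical
  intro ℓ hℓ d hd hdvd
  rw [hcard]
  have hℓp : ℓ.Prime := Nat.prime_of_mem_primeFactors hℓ
  have mem : ∀ {q : ℕ}, q ∈ N.primeFactors.erase ℓ → q.Prime ∧ 5 ≤ q ∧ q ∣ ℓ ^ d - 1 := by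
    intro q hq
    obtain ⟨hqℓ, hqN⟩ := Finset.mem_erase.1 hq
    have hqp : q.Prime := Nat.prime_of_mem_primeFactors hqN
    refine ⟨hqp, h5 q hqN, dvd_trans (Nat.dvd_ordCompl_of_dvd_not_dvd (Nat.dvd_of_mem_primeFactors hqN) ?_) hdvd⟩
    intro h
    exact hqℓ ((Nat.prime_dvd_prime_iff_eq hℓp hqp).1 h).symm
  have h4 : (N.primeFactors.erase ℓ).card = 4 := by rw [Finset.card_erase_of_mem hℓ, hcard]
  obtain ⟨q₄, m₄⟩ : (N.primeFactors.erase ℓ).Nonempty := by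
    rw [← Finset.card_pos, h4]
    norm_num
  have h3 : ((N.primeFactors.erase ℓ).erase q₄).card = 3 := by rw [Finset.card_erase_of_mem m₄, h4]
  obtain ⟨q₁, q₂, q₃, h₁₂, h₁₃, h₂₃, he⟩ := Finset.card_eq_three.1 h3
  have m₁ : q₁ ∈ (N.primeFactors.erase ℓ).erase q₄ := by rw [he]; simp
  have m₂ : q₂ ∈ (N.primeFactors.erase ℓ).erase q₄ := by rw [he]; simp
  have m₃ : q₃ ∈ (N.primeFactors.erase ℓ).erase q₄ := by rw [he]; simp
  obtain ⟨h₁₄, m₁'⟩ := Finset.mem_erase.1 m₁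
  obtain ⟨h₂₄, m₂'⟩ := Finset.mem_erase.1 m₂
  obtain ⟨h₃₄, m₃'⟩ := Finset.mem_erase.1 m₃
  obtain ⟨p₁, f₁, e₁⟩ := mem m₁'
  obtain ⟨p₂, f₂, e₂⟩ := mem m₂'
  obtain ⟨p₃, f₃, e₃⟩ := mem m₃'
  obtain ⟨p₄, f₄, e₄⟩ := mem m₄
  exact thirtyone_le_sub_one_mul_of_four_primes_dvd hℓp (h5 ℓ hℓ) hd p₁ p₂ p₃ p₄ f₁ f₂ f₃ f₄ h₁₂ h₁₃ h₂₃ h₁₄ h₂₄ h₃₄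
    e₁ e₂ e₃ e₄

/-- **THE PROPOSITION AT FIVE-PRIME LEVELS** ("Case 4", `m = 5`): if `N` has exactly five prime factors, all `≥ 5`, then
`12·#{χ mod N odd : B_{1,χ} = 0} < φ(N)`. [cite: KoblitzRohrlich1978, §2 Proposition (p. 1190) and Case 4 (pp. 1191–1192)] -/
theorem twelve_mul_card_bad_lt_totient_five_primes [NeZero N] (hcard : N.primeFactors.card = 5)
    (h5 : ∀ ℓ ∈ N.primeFactors, 5 ≤ ℓ) :
    12 * Nat.card {χ : DirichletCharacter ℂ N // χ.Odd ∧ bernoulliOneChar χ = 0} < N.totient :=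
  twelve_mul_card_bad_lt_totient_of_forall_le (criterion_five_primes hcard h5)

/-- The sibling's hypothesis at five-prime levels. [cite: KoblitzRohrlich1978, §2 Proposition (p. 1190) and Case 4 (pp. 1191–1192)] -/
theorem exists_goodFinset_five_primes [NeZero N] (hcard : N.primeFactors.card = 5) (h5 : ∀ ℓ ∈ N.primeFactors, 5 ≤ ℓ) :
    ∃ S₀ : Finset (DirichletCharacter ℂ N),
      (∀ ψ : DirichletCharacter ℂ N, ψ.Odd → bernoulliOneChar ψ = 0 → ψ ∈ S₀) ∧ 12 * S₀.card < N.totient :=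
  exists_goodFinset_of_forall_le (criterion_five_primes hcard h5)

end CaseFour

/-! ## §4 Theorems 1 (i)–(ii) and 2, relatively prime case, UNCONDITIONALLY at levels with four or five prime factors `≥ 5` -/

section FourFivePrimeLevel

open CategoryTheory
open Literature.AlgebraicGeometry.Motives (AbelianVariety)
open Literature.AlgebraicGeometry.HodgeTheory
open Literature.AlgebraicGeometry.Pohlmann1968 Literature.AlgebraicGeometry.Pohlmann1968.Cyclotomic
open CyclotomicCMTypeResidueSets (IsCMResidueSet)

variable {N : ℕ} [NeZero N]

/-- A level with four or five prime factors, all `≥ 5`, is odd, `> 1`, and carries a good finset. [folklore] -/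
private theorem level_hyps₄₅ (hm : N.primeFactors.card = 4 ∨ N.primeFactors.card = 5) (h5 : ∀ ℓ ∈ N.primeFactors, 5 ≤ ℓ) :
    1 < N ∧ Odd N ∧ ∃ S₀ : Finset (DirichletCharacter ℂ N),
      (∀ ψ : DirichletCharacter ℂ N, ψ.Odd → bernoulliOneChar ψ = 0 → ψ ∈ S₀) ∧ 12 * S₀.card < N.totient := by
  have hN0 : N ≠ 0 := NeZero.ne N
  have hN1 : 1 < N := by
    rcases Nat.lt_or_ge 1 N with h | h
    · exact h
    · exfalso
      have : N = 1 := by omega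
      rw [this, Nat.primeFactors_one, Finset.card_empty] at hm
      omega
  have hodd : Odd N := by
    rw [← Nat.not_even_iff_odd]
    intro he
    have h2 : 2 ∈ N.primeFactors := Nat.mem_primeFactors.2 ⟨Nat.prime_two, even_iff_two_dvd.1 he, hN0⟩
    exact absurd (h5 2 h2) (by norm_num)
  refine ⟨hN1, hodd, ?_⟩
  rcases hm with h | h
  · exact exists_goodFinset_four_primes h h5
  · exact exists_goodFinset_five_primes h h5

/-- **THEOREM 1 (i), unconditionally, at levels with four or five prime factors (all `≥ 5`)**: for unit triples with vanishing sums and a unit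
`h`, `H_{r₂,s₂,t₂} = h⁻¹H_{r₁,s₁,t₁}` iff `{r₂,s₂,t₂} = {hr₁,hs₁,ht₁}`. [cite: KoblitzRohrlich1978, Theorem 1 (i) (p. 1185) and §2 Proposition (pp. 1190–1192)] -/
theorem forall_mem_fermatCMType_iff_iff_multiset_eq_fourFivePrimes (hm : N.primeFactors.card = 4 ∨ N.primeFactors.card = 5)
    (h5 : ∀ ℓ ∈ N.primeFactors, 5 ≤ ℓ) {r₁ s₁ t₁ r₂ s₂ t₂ h : ZMod N}
    (hr₁ : IsUnit r₁) (hs₁ : IsUnit s₁) (ht₁ : IsUnit t₁) (h₁ : r₁ + s₁ + t₁ = 0)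
    (hr₂ : IsUnit r₂) (hs₂ : IsUnit s₂) (ht₂ : IsUnit t₂) (h₂ : r₂ + s₂ + t₂ = 0) (hh : IsUnit h) :
    (∀ x, x ∈ fermatCMType N r₂ s₂ t₂ ↔ h * x ∈ fermatCMType N r₁ s₁ t₁) ↔
      ({r₂, s₂, t₂} : Multiset (ZMod N)) = {h * r₁, h * s₁, h * t₁} := by
  obtain ⟨hN1, hN2, S₀, hS₀, hcard⟩ := level_hyps₄₅ hm h5
  exact forall_mem_fermatCMType_iff_iff_multiset_eq_of_card hN1 hN2 S₀ hS₀ hcard hr₁ hs₁ ht₁ h₁ hr₂ hs₂ ht₂ h₂ hh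

/-- **(∗)** at such levels: `H_{r₂,s₂,t₂} = H_{r₁,s₁,t₁}` iff `{r₂,s₂,t₂} = {r₁,s₁,t₁}`. [cite: KoblitzRohrlich1978, §2 (∗) (p. 1187) and Proposition (pp. 1190–1192)] -/
theorem fermatCMType_eq_iff_multiset_eq_fourFivePrimes (hm : N.primeFactors.card = 4 ∨ N.primeFactors.card = 5)
    (h5 : ∀ ℓ ∈ N.primeFactors, 5 ≤ ℓ) {r₁ s₁ t₁ r₂ s₂ t₂ : ZMod N}
    (hr₁ : IsUnit r₁) (hs₁ : IsUnit s₁) (ht₁ : IsUnit t₁) (h₁ : r₁ + s₁ + t₁ = 0)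
    (hr₂ : IsUnit r₂) (hs₂ : IsUnit s₂) (ht₂ : IsUnit t₂) (h₂ : r₂ + s₂ + t₂ = 0) :
    fermatCMType N r₂ s₂ t₂ = fermatCMType N r₁ s₁ t₁ ↔ ({r₂, s₂, t₂} : Multiset (ZMod N)) = {r₁, s₁, t₁} := by
  obtain ⟨hN1, hN2, S₀, hS₀, hcard⟩ := level_hyps₄₅ hm h5
  exact fermatCMType_eq_iff_multiset_eq_of_card hN1 hN2 S₀ hS₀ hcard hr₁ hs₁ ht₁ h₁ hr₂ hs₂ ht₂ h₂

/-- **THEOREM 2's stabiliser** at such levels. [cite: KoblitzRohrlich1978, Theorem 2 (pp. 1185–1186) and Proposition (pp. 1190–1192)] -/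
theorem forall_mem_fermatCMType_one_iff_mul_mem_iff_fourFivePrimes (hm : N.primeFactors.card = 4 ∨ N.primeFactors.card = 5)
    (h5 : ∀ ℓ ∈ N.primeFactors, 5 ≤ ℓ) {a₀ w : ZMod N} (ha₀ : IsUnit a₀) (ha₁ : IsUnit (1 + a₀)) (hw : IsUnit w) :
    (∀ x, x ∈ fermatCMType N 1 a₀ (-1 - a₀) ↔ w * x ∈ fermatCMType N 1 a₀ (-1 - a₀)) ↔
      w = 1 ∨ (1 + a₀ + a₀ ^ 2 = 0 ∧ (w = a₀ ∨ w = a₀ ^ 2)) := by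
  obtain ⟨hN1, hN2, S₀, hS₀, hcard⟩ := level_hyps₄₅ hm h5
  exact forall_mem_fermatCMType_one_iff_mul_mem_iff_of_card hN1 hN2 S₀ hS₀ hcard ha₀ ha₁ hw

variable {L : Type} [Field L] [NumberField L] [IsCyclotomicExtension {N} ℚ L]
  {A A' : AbelianVariety ℂ} {ι : 𝓞 L →+* End A} {θ : L →+* Module.End ℂ (complexBetti A.X 1)}
  {ι' : 𝓞 L →+* End A'} {θ' : L →+* Module.End ℂ (complexBetti A'.X 1)}

/-- **THEOREM 2 on CM types** at such levels: `Φ_{(1,a₀,−1−a₀)}` primitive iff NOT (`1 + a₀ + a₀² = 0` and `a₀ ≠ 1`).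
[cite: KoblitzRohrlich1978, Theorem 2 (pp. 1185–1186) and Proposition (pp. 1190–1192)] [cite: Shimura1998, §8.2 Prop. 26] -/
theorem isPrimitive_fermat_one_iff_fourFivePrimes (hm : N.primeFactors.card = 4 ∨ N.primeFactors.card = 5)
    (h5 : ∀ ℓ ∈ N.primeFactors, 5 ≤ ℓ) {a₀ : ZMod N} (ha₀ : IsUnit a₀) (ha₁ : IsUnit (1 + a₀))
    {hS : ∀ x : ZMod N, x.val.Coprime N → (x ∈ fermatCMType N 1 a₀ (-1 - a₀) ↔ -x ∉ fermatCMType N 1 a₀ (-1 - a₀))}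
    (φ₀ : L →+* ℂ) :
    IsPrimitive (ℂ ≃+* ℂ) (cmTypeOfResidues (L := L) (fermatCMType N 1 a₀ (-1 - a₀)) hS).1 φ₀ ↔
      ¬(1 + a₀ + a₀ ^ 2 = 0 ∧ a₀ ≠ 1) := by
  obtain ⟨hN1, hN2, S₀, hS₀, hcard⟩ := level_hyps₄₅ hm h5
  exact isPrimitive_fermat_one_iff_of_card hN1 hN2 S₀ hS₀ hcard ha₀ ha₁ φ₀

/-- **THEOREM 2 on abelian varieties** at such levels: simple iff NOT (`1 + a₀ + a₀² = 0` and `a₀ ≠ 1`).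
[cite: KoblitzRohrlich1978, Theorem 2 (pp. 1185–1186) and Proposition (pp. 1190–1192)] [cite: Shimura1998, §8.2 Prop. 26] -/
theorem isSimple_of_fermat_one_iff_fourFivePrimes (hm : N.primeFactors.card = 4 ∨ N.primeFactors.card = 5)
    (h5 : ∀ ℓ ∈ N.primeFactors, 5 ≤ ℓ) {a₀ : ZMod N} (ha₀ : IsUnit a₀) (ha₁ : IsUnit (1 + a₀))
    {hS : ∀ x : ZMod N, x.val.Coprime N → (x ∈ fermatCMType N 1 a₀ (-1 - a₀) ↔ -x ∉ fermatCMType N 1 a₀ (-1 - a₀))}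
    (hA : IsCMTypeRealisation (cmTypeOfResidues (L := L) (fermatCMType N 1 a₀ (-1 - a₀)) hS) A ι θ) :
    A.IsSimple ↔ ¬(1 + a₀ + a₀ ^ 2 = 0 ∧ a₀ ≠ 1) := by
  obtain ⟨hN1, hN2, S₀, hS₀, hcard⟩ := level_hyps₄₅ hm h5
  exact isSimple_of_fermat_one_iff_of_card hN1 hN2 S₀ hS₀ hcard ha₀ ha₁ hA

/-- **THEOREM 1 (ii)** at such levels: isogeny iff `{r₂,s₂,t₂} = u·{r₁,s₁,t₁}` for a unit `u`.
[cite: KoblitzRohrlich1978, Theorem 1 (ii) (p. 1185) and Proposition (pp. 1190–1192)] [cite: Shimura1998, §8.4 Example (1) and §6.1 Corollary] -/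
theorem isIsogenous_fermatCMType_iff_exists_multiset_eq_fourFivePrimes [IsCMField L]
    (hm : N.primeFactors.card = 4 ∨ N.primeFactors.card = 5) (h5 : ∀ ℓ ∈ N.primeFactors, 5 ≤ ℓ) {r₁ s₁ t₁ r₂ s₂ t₂ : ZMod N}
    (hr₁ : IsUnit r₁) (hs₁ : IsUnit s₁) (ht₁ : IsUnit t₁) (h₁ : r₁ + s₁ + t₁ = 0)
    (hr₂ : IsUnit r₂) (hs₂ : IsUnit s₂) (ht₂ : IsUnit t₂) (h₂ : r₂ + s₂ + t₂ = 0)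
    (hS : IsCMResidueSet N (fermatCMType N r₁ s₁ t₁)) (hS' : IsCMResidueSet N (fermatCMType N r₂ s₂ t₂))
    (hA : IsCMTypeRealisation (cmTypeOfResidues (L := L) (fermatCMType N r₁ s₁ t₁) hS.cm) A ι θ)
    (hA' : IsCMTypeRealisation (cmTypeOfResidues (L := L) (fermatCMType N r₂ s₂ t₂) hS'.cm) A' ι' θ') :
    AbelianVariety.IsIsogenous A A' ↔
      ∃ u : ZMod N, IsUnit u ∧ ({r₂, s₂, t₂} : Multiset (ZMod N)) = {u * r₁, u * s₁, u * t₁} := by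
  obtain ⟨hN1, hN2, S₀, hS₀, hcard⟩ := level_hyps₄₅ hm h5
  exact isIsogenous_fermatCMType_iff_exists_multiset_eq_of_card hN1 hN2 S₀ hS₀ hcard hr₁ hs₁ ht₁ h₁ hr₂ hs₂ ht₂ h₂ hS hS'
    hA hA'

end FourFivePrimeLevel

end CyclotomicFermatCMType

end Literature.AlgebraicGeometry.ComplexMultiplication
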